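import Summits.AnomalousDissipation.AnomalousDissipation.Theorems.WazewskiBlockUniformWorkFloorTrapLoadBearing
import Summits.AnomalousDissipation.AnomalousDissipation.Theorems.WazewskiBlockUniformWorkFloorTrapStubFiniteHorizon
import Summits.AnomalousDissipation.AnomalousDissipation.Theorems.WazewskiBlockUniformWorkFloorTrapLerayHopf
import Summits.AnomalousDissipation.AnomalousDissipation.Theorems.WazewskiBlockUniformWorkFloorTrapOfLoudCycles

/-!
# STRATEGY-CENSUS (typed companion) — crux `WazewskiBlock.UniformWorkFloorTrap` (stmt-AnomalousDissipation-10353)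

Crux-strategist (wall-breaker, gen 1) companion file to `Cruxes/UniformWorkFloorTrap/STRATEGY-CENSUS.md`.
Sorry-free.  It types, in the ORBIT FORM of the crux (`uniformWorkFloorTrap_iff_orbit`, p107806), the four
language switches the census must attempt, and proves the bookkeeping implications between them, so that
the census can say of each switch exactly which typed piece "remains the whole crux":

* §0  vocabulary: `InBlock`, `TrapAt ν f N E ε` (one trapped `galerkinFlow` orbit of order `N`), the
      quantifier shell `Shell P` (`∃ f, E, ε, ν₀ ∀ ν ≤ ν₀ ∃ N₀ ∀ N ≥ N₀, P`), `crux ↔ Shell TrapAt`;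
* §1  margins are free (`TrapAt.mono`, `Shell.mono`);
* §2  STRENGTHEN: `SteadyLoudAt` (steady Galerkin states in the block; dominated by the steady zeroth
      law), `CycleLoudAt` (periodic Galerkin orbits in the block; the one undominated structured shape,
      no engine) — both imply `TrapAt`; the capped crux 10352 implies the crux (landed, restated);
* §3  DECOMPOSITION: `MeanLoudAt` (bounded energy + CUMULATIVE work floor `∫₀ᵀ W ≥ εT − C` along one
      orbit = the Galerkin zeroth law in Cesàro form) and the upgrade principle `WorkFloorUpgrade`
      (mean floor ⇒ pointwise floor with `ν`-free constants); `Shell MeanLoudAt → WorkFloorUpgrade → crux`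
      PROVED, `crux → Shell MeanLoudAt` PROVED, and `MeanLoudAt ⇒` the dissipation floor
      `ν∫₀ᵀ‖∇U‖² ≥ εT − C − E` PROVED (so the piece `Shell MeanLoudAt` is still zeroth-law-class);
* §4  TRANSFER: the `x₃`-invariant (2½-D) sub-class `ColumnarTrapAt ⇒ TrapAt` (its `N → ∞`, `ν → 0`
      consequence is route TwoAndHalfD's thesis, refuted in-tree for single-shell planar forces);
* §5  NEGATION: the flushing format — `¬ TrapAt ↔ UniformExitAt` (a uniform exit time for ALL order-`N`
      orbits; `stub_finiteHorizon`, p104099) and `¬ crux ↔` "for every force and constants, viscosities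
      accumulating at `0` at which arbitrarily fine truncations flush the block uniformly".

Nothing here is a line: no `stub_*`, no `UniformWorkFloorTrap_of`.  References: p107806 (LoadBearing),
p104099 (StubFiniteHorizon), p110281 (LerayHopf), p120516 (OfLoudCycles).
-/

noncomputable section

-- `Summit.<Summit>.<Problem>`: single-conjunct summit, the duplicate namespace is mandated (CONVENTIONS §2).
set_option linter.dupNamespace false

namespace Summit.AnomalousDissipation.AnomalousDissipation.Cruxes.UniformWorkFloorTrap.StrategyCensus

open scoped InnerProductSpace ENNReal
open MeasureTheory Filter Set UnitAddTorus
open Literature.Analysis.FunctionSpaces Literature.Analysis.FunctionSpaces.Torus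
open Literature.Analysis.FluidPDE
open Summit.AnomalousDissipation.AnomalousDissipation.Theses.WazewskiBlock
  (UniformWorkFloorTrap UniformGalerkinTrap)
open Summit.AnomalousDissipation.AnomalousDissipation.Theorems.UniformWorkFloorTrap
open Summit.AnomalousDissipation.AnomalousDissipation.Theorems.UniformWorkFloorTrap.WorkLipschitzCycles
  (galerkinFlow_nat_mul_period)
open Summit.AnomalousDissipation.AnomalousDissipation.Theorems.UniformWorkFloorTrap.Sketch (stub_finiteHorizon)

local notation "𝕋³" => UnitAddTorus (Fin 3)
local notation "E³" => EuclideanSpace ℝ (Fin 3)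

variable {ν : ℝ} {N : ℕ} {f : 𝕋³ → E³} {E ε : ℝ}

/-! ## §0 Vocabulary: the orbit form of the crux -/

/-- Membership in the crux's block `B = {kineticEnergy ≤ E} ∩ {(f, ·) ≥ ε}`. [folklore] -/
def InBlock (f : 𝕋³ → E³) (E ε : ℝ) (v : 𝕋³ → E³) : Prop :=
  kineticEnergy v ≤ E ∧ ε ≤ ∫ x, ⟪f x, v x⟫_ℝ

/-- The crux at ONE `(ν, N)`, orbit form: some Galerkin mode of order `N` has its `galerkinFlow`
orbit in the block for all `t ≥ 0`. [folklore] -/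
def TrapAt (ν : ℝ) (f : 𝕋³ → E³) (N : ℕ) (E ε : ℝ) : Prop :=
  ∃ a : 𝕋³ → E³, IsGalerkinMode N a ∧ ∀ t : ℝ, 0 ≤ t → InBlock f E ε (Torus.galerkinFlow ν f N t a)

/-- The crux's quantifier shell: one mean-zero Galerkin-mode force, constants `(E, ε)` fixed BEFORE
the viscosity, then `∀ 0 < ν ≤ ν₀ ∃ N₀ ∀ N ≥ N₀`. [folklore] -/
def Shell (P : ℝ → (𝕋³ → E³) → ℕ → ℝ → ℝ → Prop) : Prop :=
  ∃ (m : ℕ) (f : 𝕋³ → E³), IsGalerkinMode m f ∧ HasZeroMean f ∧ ∃ (E ε ν₀ : ℝ), 0 < ε ∧ 0 < ν₀ ∧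
    ∀ ν : ℝ, 0 < ν → ν ≤ ν₀ → ∃ N₀ : ℕ, ∀ N : ℕ, N₀ ≤ N → P ν f N E ε

/-- **The crux is its orbit form** (p107806, restated in the census vocabulary). [folklore] -/
theorem crux_iff_shell_trapAt : UniformWorkFloorTrap ↔ Shell TrapAt :=
  uniformWorkFloorTrap_iff_orbit

/-- The orbit of a Galerkin mode is a field-level Galerkin trajectory (clause by clause,
`IsGalerkinMode.galerkinFlow_clauses`). [folklore] -/
theorem isGalerkinTrajectory_orbit {a : 𝕋³ → E³} (ha : IsGalerkinMode N a) (hν : 0 ≤ ν)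
    (hf : MemLp f 2 volume) :
    Torus.IsGalerkinTrajectory ν f N (fun t => Torus.galerkinFlow ν f N t a) := by
  obtain ⟨-, hcont, hslice, htest, henergy⟩ := ha.galerkinFlow_clauses (ν := ν) hν hf
  exact Torus.IsGalerkinTrajectory.of_isGalerkinMode hcont (fun t ht => (hslice t ht).1) htest henergy

/-! ## §1 Margins are free -/

/-- Enlarging the energy cap and lowering the work floor preserves trapping. [folklore] -/
theorem TrapAt.mono {E' ε' : ℝ} (hE : E ≤ E') (hε : ε' ≤ ε) (h : TrapAt ν f N E ε) :
    TrapAt ν f N E' ε' := by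
  obtain ⟨a, ha, hB⟩ := h
  exact ⟨a, ha, fun t ht => ⟨(hB t ht).1.trans hE, hε.trans (hB t ht).2⟩⟩

/-- The shell is monotone in its matrix. [folklore] -/
theorem Shell.mono {P Q : ℝ → (𝕋³ → E³) → ℕ → ℝ → ℝ → Prop}
    (hPQ : ∀ (m : ℕ) (ν : ℝ) (f : 𝕋³ → E³) (N : ℕ) (E ε : ℝ), IsGalerkinMode m f → 0 < ν →
      P ν f N E ε → Q ν f N E ε) (h : Shell P) : Shell Q := by
  obtain ⟨m, f, hf, hmean, E, ε, ν₀, hε, hν₀, h⟩ := h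
  refine ⟨m, f, hf, hmean, E, ε, ν₀, hε, hν₀, fun ν hν hνle => ?_⟩
  obtain ⟨N₀, hN⟩ := h ν hν hνle
  exact ⟨N₀, fun N hN₀ => hPQ m ν f N E ε hf hν (hN N hN₀)⟩

/-! ## §2 STRENGTHEN — the structured shapes -/

/-- S1. A STEADY Galerkin state of order `N` in the block (fixed by the semiflow). Its `N → ∞` limits
at fixed `ν` are smooth steady Navier–Stokes states with the same bounds, i.e. the steady zeroth law
(`CoherentStates.SteadyZerothLaw`, `MirrorVariety.GalerkinSteadyZerothLaw`): dominated. [folklore] -/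
def SteadyLoudAt (ν : ℝ) (f : 𝕋³ → E³) (N : ℕ) (E ε : ℝ) : Prop :=
  ∃ a : 𝕋³ → E³, IsGalerkinMode N a ∧ (∀ t : ℝ, 0 ≤ t → Torus.galerkinFlow ν f N t a = a) ∧ InBlock f E ε a

/-- A steady loud bounded Galerkin state is a trapped orbit. [folklore] -/
theorem trapAt_of_steadyLoudAt (h : SteadyLoudAt ν f N E ε) : TrapAt ν f N E ε := by
  obtain ⟨a, ha, hfix, hB⟩ := h
  exact ⟨a, ha, fun t ht => by rw [hfix t ht]; exact hB⟩

/-- S2. A PERIODIC Galerkin orbit of order `N` inside the block over one period (no `N`-uniform bound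
on the period, no nondegeneracy): the one structured witness shape whose `N → ∞` limits are merely
Leray–Hopf (IDEATE-r2-k5 §2 L9) — undominated, but without any existence engine. [folklore] -/
def CycleLoudAt (ν : ℝ) (f : 𝕋³ → E³) (N : ℕ) (E ε : ℝ) : Prop :=
  ∃ (a : 𝕋³ → E³) (τ : ℝ), IsGalerkinMode N a ∧ 0 < τ ∧ Torus.galerkinFlow ν f N τ a = a ∧
    ∀ t ∈ Icc (0 : ℝ) τ, InBlock f E ε (Torus.galerkinFlow ν f N t a)

/-- A loud bounded periodic Galerkin orbit is a trapped orbit (reduce `t` modulo the period with the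
semigroup law). [folklore] -/
theorem trapAt_of_cycleLoudAt (hν : 0 ≤ ν) (hf : Integrable f volume) (h : CycleLoudAt ν f N E ε) :
    TrapAt ν f N E ε := by
  obtain ⟨a, τ, ha, hτ, hper, hB⟩ := h
  refine ⟨a, ha, fun t ht => ?_⟩
  set k : ℕ := ⌊t / τ⌋₊ with hk
  have hk1 : (k : ℝ) ≤ t / τ := Nat.floor_le (div_nonneg ht hτ.le)
  have hk2 : t / τ < k + 1 := Nat.lt_floor_add_one (t / τ)
  have hkT : (k : ℝ) * τ ≤ t := by
    have := mul_le_mul_of_nonneg_right hk1 hτ.le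
    rwa [div_mul_cancel₀ t hτ.ne'] at this
  have htT : t < (k + 1) * τ := by
    have := mul_lt_mul_of_pos_right hk2 hτ
    rwa [div_mul_cancel₀ t hτ.ne'] at this
  set s : ℝ := t - k * τ with hs
  have hs0 : 0 ≤ s := by rw [hs]; linarith
  have hs1 : s ≤ τ := by rw [hs]; nlinarith
  have hkτ : (0 : ℝ) ≤ k * τ := mul_nonneg (Nat.cast_nonneg k) hτ.le
  have ht_eq : t = s + k * τ := by rw [hs]; ring
  have hflow : Torus.galerkinFlow ν f N t a = Torus.galerkinFlow ν f N s a := by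
    rw [ht_eq, ha.galerkinFlow_add hν hf hs0 hkτ, galerkinFlow_nat_mul_period ha hν hf hτ.le hper k]
  rw [hflow]
  exact hB s ⟨hs0, hs1⟩

/-- S3. The capped crux (`UniformGalerkinTrap`, stmt-10352, rank 2) implies this crux — landed
(p110281), restated. [folklore] -/
theorem crux_of_capped : UniformGalerkinTrap → UniformWorkFloorTrap :=
  uniformWorkFloorTrap_of_uniformGalerkinTrap

/-! ## §3 DECOMPOSITION — mean floor ⊕ pointwise upgrade -/

/-- Sub₁ at one `(ν, N)`: an order-`N` orbit with pointwise energy cap and a CUMULATIVE work floor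
`∫₀ᵀ (f, U) ≥ ε T − C` for all `T ≥ 0` (Cesàro/mean loudness along one orbit; `C` may depend on the
orbit). `Shell MeanLoudAt` is the Galerkin zeroth law in mean form along one bounded orbit. [folklore] -/
def MeanLoudAt (ν : ℝ) (f : 𝕋³ → E³) (N : ℕ) (E ε : ℝ) : Prop :=
  ∃ a : 𝕋³ → E³, IsGalerkinMode N a ∧
    (∀ t : ℝ, 0 ≤ t → kineticEnergy (Torus.galerkinFlow ν f N t a) ≤ E) ∧
    ∃ C : ℝ, ∀ T : ℝ, 0 ≤ T →
      ε * T - C ≤ ∫ τ in (0 : ℝ)..T, ∫ x, ⟪f x, Torus.galerkinFlow ν f N τ a x⟫_ℝ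

/-- Sub₂, the UPGRADE PRINCIPLE: for every force and constants there are `ν`-FREE constants `(E', ε')`
such that at every `(ν, N)` a mean-loud bounded orbit of order `N` yields a pointwise-loud bounded orbit
of order `N`. (Stated for all forces; false for general dissipative flows — a cycle on which the
observable changes sign — and without any mechanism for Galerkin–Navier–Stokes.) [folklore] -/
def WorkFloorUpgrade : Prop :=
  ∀ (m : ℕ) (f : 𝕋³ → E³), IsGalerkinMode m f → HasZeroMean f → ∀ E ε : ℝ, 0 < ε →
    ∃ E' ε' : ℝ, 0 < ε' ∧ ∀ (ν : ℝ) (N : ℕ), 0 < ν → m ≤ N → MeanLoudAt ν f N E ε → TrapAt ν f N E' ε'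

/-- **The typed split composes**: `Shell MeanLoudAt → WorkFloorUpgrade → Shell TrapAt`. [folklore] -/
theorem shell_trapAt_of_split (h₁ : Shell MeanLoudAt) (h₂ : WorkFloorUpgrade) : Shell TrapAt := by
  obtain ⟨m, f, hf, hmean, E, ε, ν₀, hε, hν₀, h⟩ := h₁
  obtain ⟨E', ε', hε', hup⟩ := h₂ m f hf hmean E ε hε
  refine ⟨m, f, hf, hmean, E', ε', ν₀, hε', hν₀, fun ν hν hνle => ?_⟩
  obtain ⟨N₀, hN⟩ := h ν hν hνle
  exact ⟨max N₀ m, fun N hNle =>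
    hup ν N hν (le_of_max_le_right hNle) (hN N (le_of_max_le_left hNle))⟩

/-- **The typed split concludes the crux by name.** [folklore] -/
theorem crux_of_split (h₁ : Shell MeanLoudAt) (h₂ : WorkFloorUpgrade) : UniformWorkFloorTrap :=
  crux_iff_shell_trapAt.2 (shell_trapAt_of_split h₁ h₂)

/-- Pointwise floors are cumulative floors (with `C = 0`): `TrapAt → MeanLoudAt`. [folklore] -/
theorem meanLoudAt_of_trapAt {m : ℕ} (hν : 0 ≤ ν) (hf : IsGalerkinMode m f) (h : TrapAt ν f N E ε) :
    MeanLoudAt ν f N E ε := by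
  obtain ⟨a, ha, hB⟩ := h
  have htraj := isGalerkinTrajectory_orbit (ν := ν) ha hν (hf.isSmooth.memLp 2)
  refine ⟨a, ha, fun t ht => (hB t ht).1, 0, fun T hT => ?_⟩
  have hcont := (continuousOn_work hf.isSmooth.continuous htraj).mono
    (show uIcc 0 T ⊆ Ici 0 by rw [uIcc_of_le hT]; exact fun τ hτ => hτ.1)
  · have hint : IntervalIntegrable (fun τ => ∫ x, ⟪f x, Torus.galerkinFlow ν f N τ a x⟫_ℝ) volume 0 T :=
      hcont.intervalIntegrable
    have h1 : ∫ _ in (0 : ℝ)..T, ε ≤ ∫ τ in (0 : ℝ)..T, ∫ x, ⟪f x, Torus.galerkinFlow ν f N τ a x⟫_ℝ :=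
      intervalIntegral.integral_mono_on hT intervalIntegrable_const hint fun τ hτ => (hB τ hτ.1).2
    rw [intervalIntegral.integral_const, smul_eq_mul, sub_zero, mul_comm] at h1
    linarith

/-- Hence the crux implies `Shell MeanLoudAt` (Sub₁ is a genuine weakening-or-equal). [folklore] -/
theorem shell_meanLoudAt_of_crux (h : UniformWorkFloorTrap) : Shell MeanLoudAt :=
  Shell.mono (fun m _ _ _ _ _ hf hν hT => meanLoudAt_of_trapAt (m := m) hν.le hf hT)
    (crux_iff_shell_trapAt.1 h)

/-- **Sub₁ is still zeroth-law-class**: a mean-loud bounded orbit dissipates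
`ν ∫₀ᵀ ‖∇U‖² ≥ ε T − C − E` for every `T ≥ 0` (exact energy identity), uniformly in whatever `ν, N`
the constants `E, ε, C` do not see. [folklore] -/
theorem dissipationFloor_of_meanLoudAt (hν : 0 ≤ ν) (hf : MemLp f 2 volume) (h : MeanLoudAt ν f N E ε) :
    ∃ U : ℝ → 𝕋³ → E³, Torus.IsGalerkinTrajectory ν f N U ∧
      (∀ t : ℝ, 0 ≤ t → kineticEnergy (U t) ≤ E) ∧
      ∃ C : ℝ, ∀ T : ℝ, 0 ≤ T → ε * T - C - E ≤ ν * (∫⁻ τ in Ioo 0 T, eGradNormSq (U τ)).toReal := by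
  obtain ⟨a, ha, hKE, C, hW⟩ := h
  have htraj := isGalerkinTrajectory_orbit (ν := ν) ha hν hf
  refine ⟨fun t => Torus.galerkinFlow ν f N t a, htraj, hKE, C, fun T hT => ?_⟩
  have hid := htraj.energy_eq_zero hT
  beta_reduce at hid
  have hKE0 : 0 ≤ kineticEnergy (Torus.galerkinFlow ν f N 0 a) := Torus.kineticEnergy_nonneg _
  have hKET := hKE T hT
  have hWT := hW T hT
  linarith

/-! ## §4 TRANSFER — the 2½-D (`x₃`-invariant) sub-class -/

/-- `x₃`-invariance of a field on `T³`. [folklore] -/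
def IsColumnar (v : 𝕋³ → E³) : Prop :=
  ∀ (s : UnitAddCircle) (x : 𝕋³), v (x + Pi.single (2 : Fin 3) s) = v x

/-- The transferred shape: an `x₃`-invariant force and an `x₃`-invariant trapped datum (the orbit then
stays `x₃`-invariant: planar Galerkin–NS for `(U₁,U₂)` plus a sourced passive scalar `U₃` at unit
Prandtl number — the architecture of Bruè–De Lellis 2023 / Johansson–Sorella 2024 Thm 1.5). [folklore] -/
def ColumnarTrapAt (ν : ℝ) (f : 𝕋³ → E³) (N : ℕ) (E ε : ℝ) : Prop :=
  IsColumnar f ∧ ∃ a : 𝕋³ → E³, IsGalerkinMode N a ∧ IsColumnar a ∧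
    ∀ t : ℝ, 0 ≤ t → InBlock f E ε (Torus.galerkinFlow ν f N t a)

/-- The transferred shape is a special case of the crux's orbit form. [folklore] -/
theorem trapAt_of_columnarTrapAt (h : ColumnarTrapAt ν f N E ε) : TrapAt ν f N E ε := by
  obtain ⟨-, a, ha, -, hB⟩ := h
  exact ⟨a, ha, hB⟩

/-! ## §5 NEGATION — the flushing format -/

/-- A UNIFORM EXIT TIME at `(ν, N)`: every order-`N` Galerkin orbit leaves the block by time `T`. [folklore] -/
def UniformExitAt (ν : ℝ) (f : 𝕋³ → E³) (N : ℕ) (E ε : ℝ) : Prop :=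
  ∃ T : ℝ, ∀ a : 𝕋³ → E³, IsGalerkinMode N a →
    ∃ t ∈ Icc (0 : ℝ) T, ¬ InBlock f E ε (Torus.galerkinFlow ν f N t a)

/-- A uniform exit time excludes trapped orbits. [folklore] -/
theorem not_trapAt_of_uniformExitAt (h : UniformExitAt ν f N E ε) : ¬ TrapAt ν f N E ε := by
  rintro ⟨a, ha, hB⟩
  obtain ⟨T, hT⟩ := h
  obtain ⟨t, ht, hnot⟩ := hT a ha
  exact hnot (hB t ht.1)

/-- **No trapped orbit ⇒ a uniform exit time** (compactness of the block in the finite-dimensional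
phase space: `stub_finiteHorizon`, p104099). [folklore] -/
theorem uniformExitAt_of_not_trapAt (hν : 0 ≤ ν) (hf : MemLp f 2 volume) (h : ¬ TrapAt ν f N E ε) :
    UniformExitAt ν f N E ε := by
  by_contra hcon
  apply h
  have hsoj : ∀ n : ℕ, ∃ a : 𝕋³ → E³, IsGalerkinMode N a ∧ ∀ t ∈ Icc (0 : ℝ) n,
      InBlock f E ε (Torus.galerkinFlow ν f N t a) := by
    intro n
    by_contra hn
    refine hcon ⟨n, fun a ha => ?_⟩
    by_contra hall
    refine hn ⟨a, ha, fun t ht => ?_⟩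
    by_contra hB
    exact hall ⟨t, ht, hB⟩
  obtain ⟨a, ha, hB⟩ := stub_finiteHorizon ν N f E ε hν hf hsoj
  exact ⟨a, ha, fun t ht => hB t ht⟩

/-- `¬ TrapAt ↔ UniformExitAt`. [folklore] -/
theorem not_trapAt_iff_uniformExitAt (hν : 0 ≤ ν) (hf : MemLp f 2 volume) :
    ¬ TrapAt ν f N E ε ↔ UniformExitAt ν f N E ε :=
  ⟨uniformExitAt_of_not_trapAt hν hf, not_trapAt_of_uniformExitAt⟩

/-- **The format of any refutation of the crux**: for EVERY mean-zero Galerkin-mode force and all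
constants `E`, `ε > 0`, `ν₀ > 0` there is a viscosity `0 < ν ≤ ν₀` at which, for arbitrarily fine
truncations `N`, ALL order-`N` Galerkin orbits are flushed out of the block within a uniform time.
(So the bad viscosities accumulate at `0`, and at each of them the flushing must survive `N → ∞`.) [folklore] -/
theorem not_crux_iff_flushing :
    ¬ UniformWorkFloorTrap ↔
      ∀ (m : ℕ) (f : 𝕋³ → E³), IsGalerkinMode m f → HasZeroMean f → ∀ E ε ν₀ : ℝ, 0 < ε → 0 < ν₀ →
        ∃ ν : ℝ, 0 < ν ∧ ν ≤ ν₀ ∧ ∀ N₀ : ℕ, ∃ N : ℕ, N₀ ≤ N ∧ UniformExitAt ν f N E ε := by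
  rw [crux_iff_shell_trapAt]
  constructor
  · intro h m f hf hmean E ε ν₀ hε hν₀
    by_contra hcon
    push Not at hcon
    refine h ⟨m, f, hf, hmean, E, ε, ν₀, hε, hν₀, fun ν hν hνle => ?_⟩
    obtain ⟨N₀, hN⟩ := hcon ν hν hνle
    refine ⟨N₀, fun N hN₀ => ?_⟩
    by_contra htrap
    exact hN N hN₀ (uniformExitAt_of_not_trapAt hν.le (hf.isSmooth.memLp 2) htrap)
  · rintro h ⟨m, f, hf, hmean, E, ε, ν₀, hε, hν₀, hsh⟩
    obtain ⟨ν, hν, hνle, hN⟩ := h m f hf hmean E ε ν₀ hε hν₀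
    obtain ⟨N₀, hN₀⟩ := hsh ν hν hνle
    obtain ⟨N, hle, hexit⟩ := hN N₀
    exact not_trapAt_of_uniformExitAt hexit (hN₀ N hle)

end Summit.AnomalousDissipation.AnomalousDissipation.Cruxes.UniformWorkFloorTrap.StrategyCensus

end
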